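import Mathlib
import HarnessLib
import Literature.MathematicalPhysics.StatisticalMechanics.StepKernelBoundsABKM
import Literature.MathematicalPhysics.StatisticalMechanics.WeightIntegrationDominatedStepABKM

/-!
# `StepKernelBounds` for a step kernel dominated by `(1+ρ)𝒞_{k+1}` in Fourier multipliers:
# [ABKM19] Lemma 7.7 for `q ∈ B_κ`, assembled for the torus weight data

`StepKernelBoundsABKM` records what the norm estimates of one renormalisation step consume of the
step kernel (relative to the `q = 0` weights) and proves the `q = 0` instance;
`WeightIntegrationDominatedStepABKM` proves Theorem 7.1 (w7) and the subcriticality margin against a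
step covariance whose multipliers are dominated by `(1+ρ)ĉ_{k+1}`, `0 ≤ ρ < θ̄`.  Here the two are
assembled: for the weight data `abkmWeightData … 𝒞` with the conclusions of Theorem 7.1
(`AbkmWeightBounds`), every scale `k` (`k + 1 ≤ N + 1`) and every EVEN kernel `𝒞q` with
`0 ≤ Re 𝒞̂q(κ) ≤ (1+ρ)·ĉ_{k+1}(κ)` for all modes `κ` ([ABKM19] (7.75): this is how
`𝒞^{(q)}_{k+1}`, `q ∈ B_κ`, compares to `𝒞^{(0)}_{k+1}`) and `L^{dk}|γ_q(𝒞q)| ≤ C₂`,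

* **`AbkmWeightBounds.stepKernelBounds_of_multipliers_le`** — `StepKernelBounds W L k A𝒫(ρ) C₂ 𝒞q`
  with the EXPLICIT constant `A𝒫(ρ) = weightIntConstRho θ̄ ρ (traceConst d M_ord R λ (derivSum d n C))`
  built from the regularity constants `C` of the weight kernels (clause (iv)), independent of `N`
  and `k` — so the whole `q`-family of steps is measured with ONE integration constant;
* `one_le_weightIntConstRho_abkm` — `A𝒫(ρ) ≥ 1`.

Consequently every base lemma of `StepKernelBoundsABKM` (section domination, integrability, (w7′),
smoothness of `R_{k+1}K`, `IntegrationProperty P k 𝒞q A𝒫(ρ)`) is available for such kernels.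
Everything is proved; no named fact.  Not here: the verification of the multiplier comparison for
the finite-range decomposition of `∇*(1+q)∇` from `GradientFRD.TorusFRD` (derivative bounds in the
coefficient matrix and the lower shell bounds, [ABKM19] (7.74)).

## References
* S. Adams, S. Buchholz, R. Kotecký, S. Müller, arXiv:1910.13564, Lemma 7.7 ((7.74)–(7.76)),
  Theorem 7.1 (w7) [AdamsBuchholzKoteckyMuller2019].
-/

noncomputable section

namespace Literature.MathematicalPhysics.StatisticalMechanics.GradientRG

open scoped BigOperators Classical MatrixOrder
open Finset Matrix MeasureTheory ProbabilityTheory WithLp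
open Literature.MathematicalPhysics.StatisticalMechanics.GradientFRD
  (cExt fourierCoeff mulMat circulant_eq_mulMat posSemidef_mulMat)
open Literature.MathematicalPhysics.StatisticalMechanics.TorusPolymer (IsPolymer numBlocks)

variable {d M : ℕ} [NeZero M]

omit [NeZero M] in
/-- `A𝒫(ρ) ≥ 1` for the torus constants (`0 ≤ ρ < θ̄`, `λ ≥ 0`, regularity constants `C ≥ 0` not
needed: `derivSum ≥ 0` always). [cite: AdamsBuchholzKoteckyMuller2019, Theorem 7.1 (w7)] -/
theorem one_le_weightIntConstRho_abkm {θbar ρ lam : ℝ} (hθbar : 0 < θbar) (hρ0 : 0 ≤ ρ)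
    (hρ : ρ < θbar) (hlam : 0 ≤ lam) (Mord R n : ℕ) (Cα : (Fin d → ℕ) → ℕ → ℝ) :
    1 ≤ weightIntConstRho θbar ρ (traceConst d Mord R lam (derivSum d n Cα)) :=
  one_le_weightIntConstRho hθbar hρ0 hρ (traceConst_nonneg d Mord R hlam (derivSum_nonneg d n Cα))

/-- **[ABKM19] Lemma 7.7 for `q ∈ B_κ`, as a `StepKernelBounds` instance for the torus weights.**
For the weight data `abkmWeightData L N Mord R θ̄ δ' 𝒞` with the conclusions of Theorem 7.1
(`AbkmWeightBounds`; odd `L ≥ 2^{d+3} + 16R`, `1 ≤ M_ord ≤ R`, `2M_ord ≤ n`, `d ≥ 2`, `θ̄, λ > 0`),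
the weight kernels regular to order `n` with constants `C` (clause (iv)), a scale `k` with
`k + 1 ≤ N + 1`, `0 ≤ ρ < θ̄`, and an even step kernel `𝒞q` with multipliers
`0 ≤ Re 𝒞̂q ≤ (1+ρ)ĉ_{k+1}` and `L^{dk}|γ_q(𝒞q)| ≤ C₂`:
`StepKernelBounds (abkmWeightData …) L k A𝒫(ρ) C₂ 𝒞q` with
`A𝒫(ρ) = weightIntConstRho θ̄ ρ (traceConst d M_ord R λ (derivSum d n C))`.
[cite: AdamsBuchholzKoteckyMuller2019, Lemma 7.7] -/
theorem AbkmWeightBounds.stepKernelBounds_of_multipliers_le {L N Mord R n : ℕ}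
    {θbar lam μ δ₁ δ₀ A𝒫 : ℝ} {𝒞 : ℕ → (Fin d → ZMod M) → ℝ}
    (hd : 2 ≤ d) (hMord : 1 ≤ Mord) (hMR : Mord ≤ R) (hLodd : Odd L) (hL : 2 ^ (d + 3) + 16 * R ≤ L)
    (hθbar : 0 < θbar) (hlam : 0 < lam)
    (hB : AbkmWeightBounds L N Mord R n θbar lam μ δ₁ δ₀ A𝒫 𝒞
      (abkmWeightData L N Mord R θbar (schedDelta δ₀ δ₁ N) 𝒞))
    (hn : 2 * Mord ≤ n) {Cα : (Fin d → ℕ) → ℝ}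
    (hCα : ∀ j, 1 ≤ j → j ≤ N + 1 → ∀ θ' : Fin d → ℕ, ∑ i, θ' i ≤ n →
      ∀ x, |GradientFRD.iterDiff θ' (𝒞 j) x| ≤ Cα θ' / (L : ℝ) ^ ((j - 1) * (d - 2 + ∑ i, θ' i)))
    {k : ℕ} (hk : k + 1 ≤ N + 1) {ρ : ℝ} (hρ0 : 0 ≤ ρ) (hρ : ρ < θbar)
    {𝒞q : (Fin d → ZMod M) → ℝ} (hqeven : ∀ x, 𝒞q (-x) = 𝒞q x)
    (hq_nonneg : ∀ κ, 0 ≤ (fourierCoeff 𝒞q κ).re)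
    (hq_le : ∀ κ, (fourierCoeff 𝒞q κ).re ≤ (1 + ρ) * cExt N (fun j => fourierCoeff (𝒞 j) κ) (k + 1))
    {C₂ : ℝ} (hγ : ∀ q : quadIndex d, ((L ^ (d * k) : ℕ) : ℝ) * |gradCov 𝒞q q| ≤ C₂) :
    StepKernelBounds (abkmWeightData L N Mord R θbar (schedDelta δ₀ δ₁ N) 𝒞) L k
      (weightIntConstRho θbar ρ (traceConst d Mord R lam (derivSum d n fun θ' _ => Cα θ'))) C₂ 𝒞q := by
  set W := abkmWeightData L N Mord R θbar (schedDelta δ₀ δ₁ N) 𝒞 with hW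
  set c' : (Fin d → ZMod M) → ℝ := fun κ => (fourierCoeff 𝒞q κ).re with hc'
  -- facts of the weight tower
  have heven_all : ∀ j ∈ Icc 1 (N + 1), ∀ x, 𝒞 j (-x) = 𝒞 j x := fun j hj => (hB.zero_sum_even j hj).2
  have hzero_all : ∀ j ∈ Icc 1 (N + 1), ∑ x, 𝒞 j x = 0 := fun j hj => (hB.zero_sum_even j hj).1
  have heven : ∀ x, 𝒞 (k + 1) (-x) = 𝒞 (k + 1) x :=
    heven_all (k + 1) (mem_Icc.2 ⟨by omega, hk⟩)
  have hf_even := fun κ j => GradientFRD.cExt_fourierCoeff_neg (N := N) heven_all κ j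
  have hf_zero := fun j => GradientFRD.cExt_fourierCoeff_zero_mode (N := N) hzero_all j
  have hnn := hB.multipliers_nonneg
  have hD := hB.dominated
  have hθlo : ∀ k, θbar ≤ thetaSeq θbar μ δ₁ N k := fun k => (hB.theta_mem k).1
  have hCeq := circulant_eq_mulMat_cExt hk heven (N := N)
  have hcov : W.cov k = mulMat fun κ => (1 + θbar) * cExt N (fun j => fourierCoeff (𝒞 j) κ) (k + 1) :=
    rfl
  have hreg : ∀ θ' : Fin d → ℕ, ∑ i, θ' i ≤ n → ∀ x,
      |GradientFRD.iterDiff θ' (𝒞 (k + 1)) x| ≤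
        (fun θ' (_ : ℕ) => Cα θ') θ' 0 / (L : ℝ) ^ ((k + 1 - 1) * (d - 2 + ∑ i, θ' i)) :=
    fun θ' hθ' x => hCα (k + 1) (by omega) hk θ' hθ' x
  -- facts of the step kernel
  have hCq : Matrix.circulant 𝒞q = mulMat c' := circulant_eq_mulMat hqeven
  have hc'_even : ∀ κ, c' (-κ) = c' κ := fun κ => by
    simp only [hc', GradientFRD.fourierCoeff_neg_of_even hqeven]
  -- the margin `η = (θ̄ − ρ)/(2(1+ρ))`: `(1+η)(1+ρ) = 1 + (θ̄+ρ)/2 < 1 + θ̄`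
  set η : ℝ := (θbar - ρ) / (2 * (1 + ρ)) with hηdef
  have hη0 : 0 < η := by rw [hηdef]; exact div_pos (by linarith) (by linarith)
  have hηρ : (1 + η) * (1 + ρ) < 1 + θbar := by
    have h1 : (1 + η) * (1 + ρ) = 1 + ρ + (θbar - ρ) / 2 := by
      rw [hηdef]; field_simp
    rw [h1]; linarith
  refine
    { posSemidef := by rw [hCq]; exact posSemidef_mulMat hq_nonneg
      cov_sub := by
        rw [hCq]
        exact posSemidef_cov_sub_mulMat_of_le W (c := fun j κ => cExt N (fun j => fourierCoeff (𝒞 j) κ) j)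
          hcov hρ.le (fun κ => hnn (k + 1) κ) hq_le
      subcritical := ⟨η, hη0, fun X => ?_⟩
      integral := fun X hX φ =>
        integral_weight_abkm_le_of_multipliers_le hd hMord hMR hLodd hL hθbar hlam hθlo hnn hf_zero
          hf_even hD hk heven hn hreg hρ0 hρ hqeven hq_nonneg hq_le hX φ
      gradCov_le := hγ }
  rw [hCq]
  exact posDef_one_sub_smul_form_of_le W (c := fun j κ => cExt N (fun j => fourierCoeff (𝒞 j) κ) j)
    hD hθbar (hθlo k) hlam.le hη0.le hρ0 hηρ
    (fun k κ => derivMul_neg _ k _ κ) (fun κ => derivMul_nonneg (Nat.cast_nonneg L) k _ κ)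
    (fun κ => hnn (k + 1) κ)
    (fun k κ => tailMul_neg_of_cExt hf_even k κ) (fun κ => tailMul_succ N _ k κ)
    (fun κ => tailMul_nonneg (fun κ j => hnn j κ) (k + 1) κ) hc'_even hq_nonneg hq_le X

/-- **The `q = 0` kernel is an instance of the dominated family** (`ρ = 0`): the weight kernel
`𝒞_{k+1}` itself satisfies the multiplier comparison `0 ≤ ĉ_{k+1} ≤ (1+0)ĉ_{k+1}`, so
`StepKernelBounds` holds for it with the EXPLICIT constant `A𝒫(0) = weightIntConst θ̄ (traceConst …)`
(compare `AbkmWeightBounds.stepKernelBounds`, which uses the abstract constant of `AbkmWeightBounds.integral`).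
[cite: AdamsBuchholzKoteckyMuller2019, Lemma 7.7] -/
theorem AbkmWeightBounds.stepKernelBounds_self_explicit {L N Mord R n : ℕ}
    {θbar lam μ δ₁ δ₀ A𝒫 : ℝ} {𝒞 : ℕ → (Fin d → ZMod M) → ℝ}
    (hd : 2 ≤ d) (hMord : 1 ≤ Mord) (hMR : Mord ≤ R) (hLodd : Odd L) (hL : 2 ^ (d + 3) + 16 * R ≤ L)
    (hθbar : 0 < θbar) (hlam : 0 < lam)
    (hB : AbkmWeightBounds L N Mord R n θbar lam μ δ₁ δ₀ A𝒫 𝒞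
      (abkmWeightData L N Mord R θbar (schedDelta δ₀ δ₁ N) 𝒞))
    (hn : 2 * Mord ≤ n) (hn2 : 2 ≤ n) {Cα : (Fin d → ℕ) → ℝ}
    (hCα : ∀ j, 1 ≤ j → j ≤ N + 1 → ∀ θ' : Fin d → ℕ, ∑ i, θ' i ≤ n →
      ∀ x, |GradientFRD.iterDiff θ' (𝒞 j) x| ≤ Cα θ' / (L : ℝ) ^ ((j - 1) * (d - 2 + ∑ i, θ' i)))
    {k : ℕ} (hk : k + 1 ≤ N + 1) :
    StepKernelBounds (abkmWeightData L N Mord R θbar (schedDelta δ₀ δ₁ N) 𝒞) L k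
      (weightIntConst θbar (traceConst d Mord R lam (derivSum d n fun θ' _ => Cα θ')))
      (secondDiffConst Cα) (𝒞 (k + 1)) := by
  have heven_all : ∀ j ∈ Icc 1 (N + 1), ∀ x, 𝒞 j (-x) = 𝒞 j x := fun j hj => (hB.zero_sum_even j hj).2
  have heven : ∀ x, 𝒞 (k + 1) (-x) = 𝒞 (k + 1) x :=
    heven_all (k + 1) (mem_Icc.2 ⟨by omega, hk⟩)
  have hL1 : 1 ≤ L := hLodd.pos
  have hre : ∀ κ, (fourierCoeff (𝒞 (k + 1)) κ).re = cExt N (fun j => fourierCoeff (𝒞 j) κ) (k + 1) :=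
    fun κ => (GradientFRD.cExt_of_mem (f := fun j => fourierCoeff (𝒞 j) κ) (by omega) hk).symm
  have h := AbkmWeightBounds.stepKernelBounds_of_multipliers_le hd hMord hMR hLodd hL hθbar hlam hB hn
    hCα hk le_rfl hθbar heven (fun κ => by rw [hre κ]; exact hB.multipliers_nonneg (k + 1) κ)
    (fun κ => by rw [hre κ, add_zero, one_mul])
    (fun q => abs_gradCov_abkm_le hd hn2 hL1 hCα hk q)
  rwa [weightIntConstRho_zero] at h

end Literature.MathematicalPhysics.StatisticalMechanics.GradientRG

end
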